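import Summits.SmoothPoincare4.SmoothPoincare4.Theses.SymplecticOrigami
import Summits.SmoothPoincare4.SmoothPoincare4.Theorems.SymplecticOrigamiOrigamiRungStubBallFunctionCalculus
import Summits.SmoothPoincare4.SmoothPoincare4.Theorems.SymplecticOrigamiOrigamiRungStubBallFunctionChart

/-!
# Stub `stub_ballFunction` of line `pair-rigidity-endgame`, part 3: the signed norm across the fold

`signedNorm_local` — on a manifold `X` modelled on `ℝⁿ⁺¹` with a smoothly embedded hypersurface
`f : S → X`: if `A` is an open set with `frontier A = range f` and `interior (closure A) = A`,
and `G : X → V` is smooth near `range f`, vanishes on it and has `dG ≠ 0` at `f z₀`, then the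
signed norm `σ = ‖G‖` on `closure A`, `-‖G‖` off it, is smooth near `f z₀` with `dσ ≠ 0` on
`range f`, and `G ≠ 0` off `range f` (Hadamard's lemma in the slice box of part 2,
`exists_signedNorm_model` of part 1, and the two local sides of the slice);
`stub_ballFunction_signedNormLocal` is its universe-monomorphic export with explicit binders
(the registered sub-goal). [folklore]
-/

noncomputable section

-- the prescribed namespace `Summit.<P>.<Sub>.…` duplicates `SmoothPoincare4` (P = Sub)
set_option linter.dupNamespace false

open scoped Manifold ContDiff Topology ContinuousMap
open Set TopologicalSpace
open Literature.Topology.FourManifolds (singularHomologyZ sphereInversion IsTwistedSphere)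
open Literature.Geometry.Kaehler (MForm IsSmoothForm IsClosedForm)

namespace Summit.SmoothPoincare4.SmoothPoincare4.Theorems.OrigamiRung.PairRigidityEndgame

/-! ### The signed norm across an embedded hypersurface -/

section SignedNormLocal

variable {n : ℕ} {S : Type*} [TopologicalSpace S] [ChartedSpace (EuclideanSpace ℝ (Fin n)) S]
  {X : Type*} [TopologicalSpace X] [ChartedSpace (EuclideanSpace ℝ (Fin (n + 1))) X]
  {V : Type*} [NormedAddCommGroup V] [InnerProductSpace ℝ V] [CompleteSpace V]
  {f : S → X}

/-- **The signed norm across an embedded hypersurface.** Let `f : S → X` be a smooth embedding of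
an `n`-manifold into an `(n+1)`-manifold, `A ⊆ X` open with `frontier A = range f` and
`interior (closure A) = A` (so `X ∖ range f = A ⊔ (closure A)ᶜ` and every point of `range f` is
adherent to both pieces), `G : X → V` smooth on an open `O₀`, vanishing on `O₀ ∩ range f`, with
`dG ≠ 0` at a point `f z₀ ∈ O₀`, and `σ` the *signed norm* of `G`: `‖G‖` on `closure A`, `-‖G‖`
off it. Then on an open `O ∋ f z₀` inside `O₀`: `σ` is smooth, `dσ ≠ 0` on `O ∩ range f`, and
`G ≠ 0` on `O ∖ range f`. Proof: in a slice box (`exists_slice_box`) `G` reads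
`g (a, s) = s • h (a, s)` with `h ≠ 0` (Hadamard, `exists_signedNorm_model`: `∂ₛ g ≠ 0` at the
centre because `dG ≠ 0` kills the slice directions), the two open half-boxes are preconnected
subsets of `A ⊔ (closure A)ᶜ` of which one meets `A` and the other `(closure A)ᶜ`, so
`σ = ± s ‖h‖` in the box. [folklore] -/
theorem signedNorm_local (hf : Manifold.IsSmoothEmbedding (𝓡 n) (𝓡 (n + 1)) ∞ f)
    {A : Set X} (hA : IsOpen A) (hfr : frontier A = range f) (hro : interior (closure A) = A)
    {G : X → V} {O₀ : Set X} (hO₀ : IsOpen O₀) (hG : ContMDiffOn (𝓡 (n + 1)) 𝓘(ℝ, V) ∞ G O₀)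
    (hG0 : ∀ x ∈ O₀ ∩ range f, G x = 0) {z₀ : S} (hz₀ : f z₀ ∈ O₀)
    (hdG : mfderiv (𝓡 (n + 1)) 𝓘(ℝ, V) G (f z₀) ≠ 0) {σ : X → ℝ}
    (hσ₁ : ∀ x ∈ closure A, σ x = ‖G x‖) (hσ₂ : ∀ x, x ∉ closure A → σ x = -‖G x‖) :
    ∃ O : Set X, IsOpen O ∧ f z₀ ∈ O ∧ O ⊆ O₀ ∧ ContMDiffOn (𝓡 (n + 1)) 𝓘(ℝ, ℝ) ∞ σ O ∧
      (∀ x ∈ O ∩ range f, mfderiv (𝓡 (n + 1)) 𝓘(ℝ, ℝ) σ x ≠ 0) ∧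
      (∀ x ∈ O, x ∉ range f → G x ≠ 0) := by
  obtain ⟨φ, T, r₀, hr₀, hφ, hx₀φ, hc2, hballT, hslice⟩ := exists_slice_box hf z₀
  set x₀ := f z₀ with hx₀
  obtain ⟨a₀, hc⟩ : ∃ a₀ : EuclideanSpace ℝ (Fin n), T (φ x₀) = (a₀, 0) :=
    ⟨(T (φ x₀)).1, Prod.ext rfl hc2⟩
  rw [hc] at hballT hslice
  -- facts about the two sides
  have hx₀r : x₀ ∈ range f := ⟨z₀, rfl⟩
  have hfrcl : range f ⊆ closure A := hfr ▸ frontier_subset_closure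
  have hfrA' : Disjoint A (range f) := by
    rw [← hfr, disjoint_iff_inter_eq_empty]
    exact hA.inter_frontier_eq
  have hfrA : ∀ x, x ∉ range f → x ∈ A ∪ (closure A)ᶜ := by
    intro x hx
    rw [← hfr, ← closure_sdiff_interior, hA.interior_eq] at hx
    by_cases hxc : x ∈ closure A
    · exact Or.inl (by_contra fun hxA => hx ⟨hxc, hxA⟩)
    · exact Or.inr hxc
  have hdisj : Disjoint A (closure A)ᶜ := disjoint_compl_right.mono_left subset_closure
  -- the chart map `k = T ∘ φ` and its inverse `j = φ⁻¹ ∘ T⁻¹`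
  set k : X → (EuclideanSpace ℝ (Fin n)) × ℝ := fun x => T (φ x) with hk
  set j : (EuclideanSpace ℝ (Fin n)) × ℝ → X := fun q => φ.symm (T.symm q) with hj
  have hkx₀ : k x₀ = (a₀, 0) := hc
  have hjk : ∀ x ∈ φ.source, j (k x) = x := fun x hx => by
    simp only [hj, hk, ContinuousLinearEquiv.symm_apply_apply, φ.left_inv hx]
  have hkj : ∀ q, T.symm q ∈ φ.target → k (j q) = q := fun q hq => by
    simp only [hj, hk, φ.right_inv hq, ContinuousLinearEquiv.apply_symm_apply]
  have hjsrc : ∀ q, T.symm q ∈ φ.target → j q ∈ φ.source := fun q hq => φ.map_target hq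
  have hslk : ∀ x ∈ φ.source, k x ∈ Metric.ball ((a₀, 0) : (EuclideanSpace ℝ (Fin n)) × ℝ) r₀ →
      (x ∈ range f ↔ (k x).2 = 0) := hslice
  have hks : ContMDiffOn (𝓡 (n + 1)) 𝓘(ℝ, (EuclideanSpace ℝ (Fin n)) × ℝ) ∞ k φ.source :=
    T.contDiff.contMDiff.comp_contMDiffOn (contMDiffOn_of_mem_maximalAtlas hφ)
  have hjs : ContMDiffOn 𝓘(ℝ, (EuclideanSpace ℝ (Fin n)) × ℝ) (𝓡 (n + 1)) ∞ j
      (T.symm ⁻¹' φ.target) :=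
    (contMDiffOn_symm_of_mem_maximalAtlas hφ).comp T.symm.contDiff.contMDiff.contMDiffOn
      fun q hq => hq
  -- `G` read in the chart: `g = G ∘ j`, smooth on the open set `U₀ ∋ (a₀, 0)`
  set g : (EuclideanSpace ℝ (Fin n)) × ℝ → V := fun q => G (j q) with hg
  have hgk : ∀ x ∈ φ.source, g (k x) = G x := fun x hx => by simp only [hg, hjk x hx]
  set U₀ : Set ((EuclideanSpace ℝ (Fin n)) × ℝ) :=
    T.symm ⁻¹' (φ.target ∩ φ.symm ⁻¹' O₀) ∩ Metric.ball (a₀, 0) r₀ with hU₀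
  have hU₀o : IsOpen U₀ :=
    ((φ.isOpen_inter_preimage_symm hO₀).preimage T.symm.continuous).inter Metric.isOpen_ball
  have hU₀t : ∀ q ∈ U₀, T.symm q ∈ φ.target := fun q hq => hq.1.1
  have hU₀O : ∀ q ∈ U₀, j q ∈ O₀ := fun q hq => hq.1.2
  have ha₀U : ((a₀, 0) : (EuclideanSpace ℝ (Fin n)) × ℝ) ∈ U₀ := by
    refine ⟨?_, Metric.mem_ball_self hr₀⟩
    show T.symm (a₀, 0) ∈ φ.target ∩ φ.symm ⁻¹' O₀
    rw [← hc, ContinuousLinearEquiv.symm_apply_apply]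
    exact ⟨φ.map_source hx₀φ, by rw [mem_preimage, φ.left_inv hx₀φ]; exact hz₀⟩
  have hgs : ContDiffOn ℝ ∞ g U₀ := by
    rw [← contMDiffOn_iff_contDiffOn]
    exact hG.comp (hjs.mono fun q hq => hU₀t q hq) fun q hq => hU₀O q hq
  -- `g` vanishes on the slice
  have hg0 : ∀ a : EuclideanSpace ℝ (Fin n), ((a, 0) : (EuclideanSpace ℝ (Fin n)) × ℝ) ∈ U₀ →
      g (a, 0) = 0 := by
    intro a ha
    have hkja : k (j (a, 0)) = (a, 0) := hkj _ (hU₀t _ ha)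
    have hmem : j (a, 0) ∈ range f := by
      refine (hslk _ (hjsrc _ (hU₀t _ ha)) ?_).2 ?_
      · rw [hkja]; exact ha.2
      · rw [hkja]
    exact hG0 _ ⟨hU₀O _ ha, hmem⟩
  -- `∂ₛ g (a₀, 0) ≠ 0`: otherwise `Dg (a₀, 0) = 0` (it kills the slice), hence `dG (x₀) = 0`
  have hgd : DifferentiableAt ℝ g (a₀, 0) :=
    (hgs.contDiffAt (hU₀o.mem_nhds ha₀U)).differentiableAt (by simp)
  have hd : fderiv ℝ g (a₀, 0) (0, 1) ≠ 0 := by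
    intro h01
    have hsl : ∀ v : EuclideanSpace ℝ (Fin n), fderiv ℝ g (a₀, 0) (v, 0) = 0 := by
      intro v
      set ι₀ : EuclideanSpace ℝ (Fin n) → (EuclideanSpace ℝ (Fin n)) × ℝ := fun a => (a, 0) with hι₀
      have hcont : Continuous ι₀ := continuous_id.prodMk continuous_const
      have hev : g ∘ ι₀ =ᶠ[𝓝 a₀] fun _ => 0 := by
        filter_upwards [hcont.continuousAt.preimage_mem_nhds (hU₀o.mem_nhds ha₀U)] with a ha
        exact hg0 a ha
      have h1 : HasFDerivAt (g ∘ ι₀)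
          ((fderiv ℝ g (a₀, 0)).comp (ContinuousLinearMap.inl ℝ (EuclideanSpace ℝ (Fin n)) ℝ)) a₀ :=
        HasFDerivAt.comp a₀ (hg := hgd.hasFDerivAt) (hf := hasFDerivAt_prodMk_left a₀ 0)
      have h2 : fderiv ℝ (g ∘ ι₀) a₀ = 0 := by
        rw [hev.fderiv_eq, fderiv_const_apply]
      have h3 :=
        congrArg (fun L : (EuclideanSpace ℝ (Fin n)) →L[ℝ] V => L v) (h1.fderiv.symm.trans h2)
      simpa using h3
    have hzero : fderiv ℝ g (a₀, 0) = 0 := by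
      refine ContinuousLinearMap.ext fun w => ?_
      obtain ⟨v, s⟩ := w
      have hsplit :
          ((v, s) : (EuclideanSpace ℝ (Fin n)) × ℝ) =
            (v, 0) + s • ((0 : EuclideanSpace ℝ (Fin n)), (1 : ℝ)) := by
        simp
      rw [hsplit, map_add, map_smul, hsl v, h01, smul_zero, zero_add]
      rfl
    have hGk : G =ᶠ[𝓝 x₀] g ∘ k := by
      filter_upwards [φ.open_source.mem_nhds hx₀φ] with x hx
      rw [Function.comp_apply, hgk x hx]
    have hkd : MDifferentiableAt (𝓡 (n + 1)) 𝓘(ℝ, (EuclideanSpace ℝ (Fin n)) × ℝ) k x₀ :=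
      (hks.contMDiffAt (φ.open_source.mem_nhds hx₀φ)).mdifferentiableAt (by simp)
    have hgd' : MDifferentiableAt 𝓘(ℝ, (EuclideanSpace ℝ (Fin n)) × ℝ) 𝓘(ℝ, V) g (k x₀) := by
      rw [hkx₀]
      exact hgd.mdifferentiableAt
    have hcomp := mfderiv_comp x₀ hgd' hkd
    rw [← hGk.mfderiv_eq, mfderiv_eq_fderiv, hkx₀, hzero] at hcomp
    exact hdG (by rw [hcomp]; ext v; rfl)
  -- the signed norm in the model
  obtain ⟨τ, r, hr, hballU, hτ, hτ₁, hτ₂, hgne, hdτ⟩ :=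
    exists_signedNorm_model hU₀o ha₀U hgs hg0 hd
  have hballt : ∀ q ∈ Metric.ball ((a₀, 0) : (EuclideanSpace ℝ (Fin n)) × ℝ) r,
      T.symm q ∈ φ.target :=
    fun q hq => hU₀t q (hballU hq)
  -- the box `O`
  set O : Set X :=
    {x | x ∈ φ.source ∧ k x ∈ Metric.ball ((a₀, 0) : (EuclideanSpace ℝ (Fin n)) × ℝ) r} with hO
  have hOo : IsOpen O :=
    (T.continuous.comp_continuousOn φ.continuousOn).isOpen_inter_preimage φ.open_source
      Metric.isOpen_ball
  have hx₀O : x₀ ∈ O := ⟨hx₀φ, by rw [hkx₀]; exact Metric.mem_ball_self hr⟩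
  have hOO₀ : O ⊆ O₀ := fun x hx => by
    have := hU₀O _ (hballU hx.2)
    rwa [hjk x hx.1] at this
  have hjO : ∀ q ∈ Metric.ball ((a₀, 0) : (EuclideanSpace ℝ (Fin n)) × ℝ) r, j q ∈ O := fun q hq =>
    ⟨hjsrc q (hballt q hq), by rw [hkj q (hballt q hq)]; exact hq⟩
  have hsl : ∀ x ∈ O, (x ∈ range f ↔ (k x).2 = 0) := fun x hx =>
    hslice x hx.1 (hballU hx.2).2
  -- the two half-boxes `P = {s > 0}`, `Q = {s < 0}` lie each in `A` or in `(closure A)ᶜ`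
  have hside : ∀ s : Set ℝ, Convex ℝ s → (0 : ℝ) ∉ s →
      j '' (Metric.ball ((a₀, 0) : (EuclideanSpace ℝ (Fin n)) × ℝ) r ∩ Prod.snd ⁻¹' s) ⊆ A ∨
        j '' (Metric.ball ((a₀, 0) : (EuclideanSpace ℝ (Fin n)) × ℝ) r ∩ Prod.snd ⁻¹' s) ⊆
          (closure A)ᶜ := by
    intro s hs h0
    refine IsPreconnected.subset_or_subset hA isClosed_closure.isOpen_compl hdisj ?_ ?_
    · rintro _ ⟨q, ⟨hq, hqs⟩, rfl⟩
      refine hfrA _ fun hmem => h0 ?_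
      have h2 : (k (j q)).2 = 0 := (hsl _ (hjO q hq)).1 hmem
      rw [hkj q (hballt q hq)] at h2
      rw [mem_preimage, h2] at hqs
      exact hqs
    · exact ((convex_ball _ _).inter
          (hs.linear_preimage
            (LinearMap.snd ℝ (EuclideanSpace ℝ (Fin n)) ℝ))).isPreconnected.image _
        (hjs.continuousOn.mono fun q hq => hballt q hq.1)
  set P : Set X :=
    j '' (Metric.ball ((a₀, 0) : (EuclideanSpace ℝ (Fin n)) × ℝ) r ∩ Prod.snd ⁻¹' Ioi 0) with hP
  set Q : Set X :=
    j '' (Metric.ball ((a₀, 0) : (EuclideanSpace ℝ (Fin n)) × ℝ) r ∩ Prod.snd ⁻¹' Iio 0) with hQ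
  have hPmem : ∀ x ∈ O, 0 < (k x).2 → x ∈ P := fun x hx h => ⟨k x, ⟨hx.2, h⟩, hjk x hx.1⟩
  have hQmem : ∀ x ∈ O, (k x).2 < 0 → x ∈ Q := fun x hx h => ⟨k x, ⟨hx.2, h⟩, hjk x hx.1⟩
  have hPside := hside (Ioi 0) (convex_Ioi 0) fun h => lt_irrefl (0 : ℝ) h
  have hQside := hside (Iio 0) (convex_Iio 0) fun h => lt_irrefl (0 : ℝ) h
  -- `O` meets both sides, at points off the slice
  obtain ⟨y, hyO, hyA⟩ : (O ∩ A).Nonempty := mem_closure_iff.1 (hfrcl hx₀r) O hOo hx₀O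
  obtain ⟨y', hy'O, hy'A⟩ : (O ∩ (closure A)ᶜ).Nonempty := by
    have h : x₀ ∈ closure (closure A)ᶜ := by
      rw [closure_compl, hro]
      exact fun h => hfrA'.notMem_of_mem_left h hx₀r
    exact mem_closure_iff.1 h O hOo hx₀O
  have hyk : (k y).2 ≠ 0 := fun h => hfrA'.notMem_of_mem_left hyA ((hsl y hyO).2 h)
  have hy'k : (k y').2 ≠ 0 := fun h => hy'A (hfrcl ((hsl y' hy'O).2 h))
  -- hence `σ = ε τ ∘ k` on `O` for a sign `ε`
  obtain ⟨ε, hε, hkey⟩ : ∃ ε : ℝ, ε ≠ 0 ∧ ∀ x ∈ O, σ x = ε * τ (k x) := by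
    rcases hyk.lt_or_gt with hyneg | hypos
    · -- `Q` meets `A`, so `Q ⊆ A` and `P ⊆ (closure A)ᶜ`: `ε = -1`
      have hQA : Q ⊆ A :=
        hQside.resolve_right fun h => h (hQmem y hyO hyneg) (subset_closure hyA)
      have hy'pos : 0 < (k y').2 := by
        rcases hy'k.lt_or_gt with h | h
        · exact absurd (subset_closure (hQA (hQmem y' hy'O h))) hy'A
        · exact h
      have hPA : P ⊆ (closure A)ᶜ :=
        hPside.resolve_left fun h => hy'A (subset_closure (h (hPmem y' hy'O hy'pos)))
      refine ⟨-1, by norm_num, fun x hx => ?_⟩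
      rcases lt_trichotomy (k x).2 0 with hlt | heq | hgt
      · rw [hσ₁ x (subset_closure (hQA (hQmem x hx hlt))), hτ₂ _ hx.2 hlt.le, hgk x hx.1]
        ring
      · rw [hσ₁ x (hfrcl ((hsl x hx).2 heq)), hτ₁ _ hx.2 heq.ge, hgk x hx.1,
          hG0 x ⟨hOO₀ hx, (hsl x hx).2 heq⟩]
        simp
      · rw [hσ₂ x (hPA (hPmem x hx hgt)), hτ₁ _ hx.2 hgt.le, hgk x hx.1]
        ring
    · -- `P` meets `A`, so `P ⊆ A` and `Q ⊆ (closure A)ᶜ`: `ε = 1`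
      have hPA : P ⊆ A :=
        hPside.resolve_right fun h => h (hPmem y hyO hypos) (subset_closure hyA)
      have hy'neg : (k y').2 < 0 := by
        rcases hy'k.lt_or_gt with h | h
        · exact h
        · exact absurd (subset_closure (hPA (hPmem y' hy'O h))) hy'A
      have hQA : Q ⊆ (closure A)ᶜ :=
        hQside.resolve_left fun h => hy'A (subset_closure (h (hQmem y' hy'O hy'neg)))
      refine ⟨1, one_ne_zero, fun x hx => ?_⟩
      rcases lt_trichotomy (k x).2 0 with hlt | heq | hgt
      · rw [hσ₂ x (hQA (hQmem x hx hlt)), hτ₂ _ hx.2 hlt.le, hgk x hx.1]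
        ring
      · rw [hσ₁ x (hfrcl ((hsl x hx).2 heq)), hτ₁ _ hx.2 heq.ge, hgk x hx.1]
        ring
      · rw [hσ₁ x (subset_closure (hPA (hPmem x hx hgt))), hτ₁ _ hx.2 hgt.le, hgk x hx.1]
        ring
  -- smoothness of `σ` on `O`
  have hτm : ContMDiffOn 𝓘(ℝ, (EuclideanSpace ℝ (Fin n)) × ℝ) 𝓘(ℝ, ℝ) ∞ (fun q => ε * τ q)
      (Metric.ball ((a₀, 0) : (EuclideanSpace ℝ (Fin n)) × ℝ) r) :=
    contMDiffOn_iff_contDiffOn.2 (contDiffOn_const.mul hτ)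
  have hσO : ContMDiffOn (𝓡 (n + 1)) 𝓘(ℝ, ℝ) ∞ σ O :=
    (hτm.comp (hks.mono fun x hx => hx.1) fun x hx => hx.2).congr fun x hx => hkey x hx
  refine ⟨O, hOo, hx₀O, hOO₀, hσO, fun x hx hzero => ?_, fun x hx hxr => ?_⟩
  · -- `dσ ≠ 0` on the slice: read `σ ∘ j = ε τ` near `k x`
    obtain ⟨hxO, hxr⟩ := hx
    have hq2 : (k x).2 = 0 := (hsl x hxO).1 hxr
    have hqb : k x ∈ Metric.ball ((a₀, 0) : (EuclideanSpace ℝ (Fin n)) × ℝ) r := hxO.2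
    have hσj : σ ∘ j =ᶠ[𝓝 (k x)] fun q => ε * τ q := by
      filter_upwards [Metric.isOpen_ball.mem_nhds hqb] with q hq
      rw [Function.comp_apply, hkey _ (hjO q hq), hkj q (hballt q hq)]
    have hjd : MDifferentiableAt 𝓘(ℝ, (EuclideanSpace ℝ (Fin n)) × ℝ) (𝓡 (n + 1)) j (k x) :=
      (hjs.contMDiffAt ((φ.open_target.preimage T.symm.continuous).mem_nhds
        (hballt _ hqb))).mdifferentiableAt (by simp)
    have hσd : MDifferentiableAt (𝓡 (n + 1)) 𝓘(ℝ, ℝ) σ (j (k x)) := by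
      rw [hjk x hxO.1]
      exact (hσO.contMDiffAt (hOo.mem_nhds hxO)).mdifferentiableAt (by simp)
    have hcomp :
        (fderiv ℝ (fun q => ε * τ q) (k x) : ((EuclideanSpace ℝ (Fin n)) × ℝ) →L[ℝ] ℝ) = 0 := by
      have h := mfderiv_comp (k x) hσd hjd
      rw [hjk x hxO.1, hzero, hσj.mfderiv_eq, mfderiv_eq_fderiv] at h
      rw [h]
      exact ContinuousLinearMap.ext fun v => rfl
    have hτd : DifferentiableAt ℝ τ (k x) :=
      (hτ.contDiffAt (Metric.isOpen_ball.mem_nhds hqb)).differentiableAt (by simp)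
    rw [(hτd.hasFDerivAt.const_mul ε).fderiv] at hcomp
    rcases smul_eq_zero.1 hcomp with h | h
    · exact hε h
    · exact hdτ _ hqb hq2 (by rw [h]; rfl)
  · -- `G ≠ 0` off the slice
    have hq2 : (k x).2 ≠ 0 := fun h => hxr ((hsl x hx).2 h)
    rw [← hgk x hx.1]
    exact hgne _ hx.2 hq2

end SignedNormLocal

/-- **Registered sub-goal (explicit binders, universe `0`)**: the signed norm across an embedded
hypersurface, `signedNorm_local`. [folklore] -/
theorem stub_ballFunction_signedNormLocal :
    ∀ (n : ℕ) (S : Type) [TopologicalSpace S] [ChartedSpace (EuclideanSpace ℝ (Fin n)) S]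
      (X : Type) [TopologicalSpace X] [ChartedSpace (EuclideanSpace ℝ (Fin (n + 1))) X]
      (V : Type) [NormedAddCommGroup V] [InnerProductSpace ℝ V] [CompleteSpace V]
      (f : S → X) (A O₀ : Set X) (G : X → V) (σ : X → ℝ) (z₀ : S),
      Manifold.IsSmoothEmbedding (𝓡 n) (𝓡 (n + 1)) ∞ f → IsOpen A → frontier A = Set.range f →
      interior (closure A) = A → IsOpen O₀ → ContMDiffOn (𝓡 (n + 1)) 𝓘(ℝ, V) ∞ G O₀ →
      (∀ x ∈ O₀ ∩ Set.range f, G x = 0) → f z₀ ∈ O₀ →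
      mfderiv (𝓡 (n + 1)) 𝓘(ℝ, V) G (f z₀) ≠ 0 →
      (∀ x ∈ closure A, σ x = ‖G x‖) → (∀ x, x ∉ closure A → σ x = -‖G x‖) →
      ∃ O : Set X, IsOpen O ∧ f z₀ ∈ O ∧ O ⊆ O₀ ∧ ContMDiffOn (𝓡 (n + 1)) 𝓘(ℝ, ℝ) ∞ σ O ∧
        (∀ x ∈ O ∩ Set.range f, mfderiv (𝓡 (n + 1)) 𝓘(ℝ, ℝ) σ x ≠ 0) ∧
        (∀ x ∈ O, x ∉ Set.range f → G x ≠ 0) :=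
  fun _ _ _ _ _ _ _ _ _ _ _ _ _ _ _ _ _ hf hA hfr hro hO₀ hG hG0 hz₀ hdG hσ₁ hσ₂ =>
    signedNorm_local hf hA hfr hro hO₀ hG hG0 hz₀ hdG hσ₁ hσ₂

end Summit.SmoothPoincare4.SmoothPoincare4.Theorems.OrigamiRung.PairRigidityEndgame

end
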